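import Summits.ValiantsHypothesis.ValiantsHypothesis.Theorems.SymPencilSdcPerFourTwentySeven
import Summits.ValiantsHypothesis.ValiantsHypothesis.Theorems.SymPencilPerFourOneRowDefectTwoKernel
import Summits.ValiantsHypothesis.ValiantsHypothesis.Theorems.SymPencilPerFourOneRowDefectTwoEndgame
import Summits.ValiantsHypothesis.ValiantsHypothesis.Theorems.SymPencilBasePointDetConst

/-!
# Route `SymPencil` — the size-`27` cell `(12,4,2)` of the kernel-package table is EMPTY, given
# hyperplane flow rigidity of `per [𝟙; ·]` (`--supports` stmt-ValiantsHypothesis-5674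
# `SdcSuperquadratic`; rung currency `27 ≤ sdc(per₄) ≤ 29`, one of five size-`27` cells; nothing
# here bears on `VP ≠ VNP`)

In the base-point package of a symmetric affine determinantal representation of `per_4` of size
`m ≤ 27` over an algebraically closed field of characteristic `0`
(`SymPencilPerFourBasePointPackage`), suppose the kernel rows span `r = 12` dimensions.  Then
`dim ker bL = 4` and the defect is `|ι'| - 2r ≤ 2`, so the kernel carries a joint two-square
family (`SymPencilIsotropicKernelSquaresBilinear`), all `2 × 2` subpermanents vanish on it
(`SymPencilPerFourHessianBlocks`) and the kernel is ONE ROW or ONE COLUMN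
(`SymPencilPerFourBlocksEq`).  Sizes `m ≤ 26` are `SymPencilSdcPerFourTwentySeven`; at `m = 27`
(defect two) the kernel invariance of `SymPencilPerFourOneRowCells` is no longer available and
is replaced by the invariant Lagrangian extension and the abstract flow identities of
`SymPencilPerFourOneRowDefectTwoKernel` (base row `w = 𝟙`, determinant constancy from
`SymPencilBasePointDetConst`), which `SymPencilPerFourOneRowDefectTwoEndgame` refutes GIVEN the
hyperplane flow rigidity of `F = per [𝟙; ·]`:

  (RIG) for every linear `X` and linear form `ℓ` on `K^{3×4}` with `F(y + t X y) = F(y)` for all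
  `y ∈ ker ℓ` and all `t`, there is `y ∈ ker ℓ` with `X y = 0` and `F(y) ≠ 0`.

**Theorems.** `false_of_row_kernel_of_rigid`, `false_of_col_kernel_of_rigid` (the one-row /
one-column kernel at defect `≤ 2`, given (RIG) and determinant constancy), and
`false_of_rank_twelve_le_twentySeven_of_rigid` (the cell, `IsAlgClosed`, given (RIG)).  (RIG) is
an explicit hypothesis here (as the LIST hypothesis was for `(10,6,6)` in
`SymPencilSdcPerFourCellTenSix`); it is the statement the files `SymPencilPerFourHyperplaneFlow*`
are to prove.  Honest framing: one of five size-`27` cells; the window `27 ≤ sdc(per₄) ≤ 29` moves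
only when all five die; no definitions, no named facts. [folklore]
-/

noncomputable section

-- single-conjunct layout: Sub = Summit, duplicated namespace component intended
set_option linter.dupNamespace false

namespace Summit.ValiantsHypothesis.ValiantsHypothesis.Theorems.SymPencilSdcPerFourCellTwelveFour

open Matrix MvPolynomial Module
open Literature.Computability.AlgebraicComplexity
open Summit.ValiantsHypothesis.ValiantsHypothesis.Theorems.SymPencilPerFourBasePointPackage
open Summit.ValiantsHypothesis.ValiantsHypothesis.Theorems.SymPencilPerFourOneRowCells
open Summit.ValiantsHypothesis.ValiantsHypothesis.Theorems.SymPencilIsotropicKernelSquaresBilinear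
open Summit.ValiantsHypothesis.ValiantsHypothesis.Theorems.SymPencilPerFourHessianBlocks
open Summit.ValiantsHypothesis.ValiantsHypothesis.Theorems.SymPencilPerFourBlocksEq
open Summit.ValiantsHypothesis.ValiantsHypothesis.Theorems.SymPencilSdcPerFourTwentySeven
open Summit.ValiantsHypothesis.ValiantsHypothesis.Theorems.SymPencilPerFourOneRowDefectTwoKernel
open Summit.ValiantsHypothesis.ValiantsHypothesis.Theorems.SymPencilPerFourOneRowDefectTwoEndgame
open Summit.ValiantsHypothesis.ValiantsHypothesis.Theorems.SymPencilBasePointDetConst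

universe u

variable {K : Type u} [Field K] [CharZero K] {ι' : Type*} [Fintype ι'] [DecidableEq ι']

/-- **The one-ROW kernel cell at defect `≤ 2` is empty, given hyperplane flow rigidity of
`per [𝟙; ·]`.**  See the module docstring. [folklore] -/
theorem false_of_row_kernel_of_rigid {D : Matrix ι' ι' K} (hD : IsUnit D.det) (hDs : Dᵀ = D)
    (bL : (Fin 4 × Fin 4 → K) →ₗ[K] (ι' → K))
    (CL : (Fin 4 × Fin 4 → K) →ₗ[K] Matrix ι' ι' K) (hCs : ∀ z, (CL z)ᵀ = CL z)
    {κ : K} (hκ : κ ≠ 0)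
    (hiii : ∀ z, D.det * (bL z ⬝ᵥ (D⁻¹ * CL z * D⁻¹ * CL z * D⁻¹) *ᵥ bL z) =
      -(κ * MvPolynomial.eval z (perPoly (Fin 4) K)))
    (hN : ∀ v, bL v = 0 → IsUnit (D + CL v).det ∧ ∀ (z : Fin 4 × Fin 4 → K) (s : K),
      κ * MvPolynomial.eval (v + s • z) (perPoly (Fin 4) K) =
        (Matrix.fromBlocks ((s * 0) • (1 : Matrix Unit Unit K))
          (Matrix.replicateRow Unit (s • bL z)) (Matrix.replicateCol Unit (s • bL z))
          (D + CL v + s • CL z)).det)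
    (hdef : Fintype.card ι' ≤ 2 * finrank K (LinearMap.range bL) + 2)
    (hdet : ∀ v, bL v = 0 → ∀ t : K, (D + t • CL v).det = D.det)
    (hrig : ∀ (X : (Fin 3 → Fin 4 → K) →ₗ[K] (Fin 3 → Fin 4 → K))
      (ℓ : (Fin 3 → Fin 4 → K) →ₗ[K] K),
      (∀ y, ℓ y = 0 → ∀ t : K,
        (Matrix.of ![fun _ => (1 : K), (y + t • X y) 0, (y + t • X y) 1,
            (y + t • X y) 2]).permanent =
          (Matrix.of ![fun _ => (1 : K), y 0, y 1, y 2]).permanent) →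
      ∃ y, ℓ y = 0 ∧ X y = 0 ∧ (Matrix.of ![fun _ => (1 : K), y 0, y 1, y 2]).permanent ≠ 0)
    (l : Fin 4) (hrow : ∀ x, bL x = 0 → ∀ i j, i ≠ l → x (i, j) = 0)
    (hk4 : finrank K (LinearMap.ker bL) = 4) : False := by
  classical
  -- the embeddings of the row `l` and of the other rows (as in `SymPencilPerFourOneRowCells`)
  let embV : (Fin 4 → K) →ₗ[K] (Fin 4 × Fin 4 → K) :=
    { toFun := fun w p => if p.1 = l then w p.2 else 0
      map_add' := fun w w' => by
        funext p; simp only [Pi.add_apply]; split_ifs <;> simp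
      map_smul' := fun c w => by
        funext p; simp only [Pi.smul_apply, smul_eq_mul, RingHom.id_apply]; split_ifs <;> simp }
  have hembV : ∀ w p, embV w p = if p.1 = l then w p.2 else 0 := fun _ _ => rfl
  let σ := finSuccAboveEquiv l
  have hσ : ∀ a (h : l.succAbove a ≠ l), σ.symm ⟨l.succAbove a, h⟩ = a := fun a h => by
    rw [Equiv.symm_apply_eq]; exact Subtype.ext (finSuccAboveEquiv_apply l a ▸ rfl)
  let embX : (Fin 3 → Fin 4 → K) →ₗ[K] (Fin 4 × Fin 4 → K) :=
    { toFun := fun x p => if h : p.1 = l then 0 else x (σ.symm ⟨p.1, h⟩) p.2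
      map_add' := fun x x' => by
        funext p; simp only [Pi.add_apply]; split_ifs <;> simp
      map_smul' := fun c x => by
        funext p; simp only [Pi.smul_apply, smul_eq_mul, RingHom.id_apply]; split_ifs <;> simp }
  have hembXl : ∀ x j, embX x (l, j) = 0 := fun x j => by
    show (if h : ((l, j) : Fin 4 × Fin 4).1 = l then (0 : K) else _) = 0
    rw [dif_pos rfl]
  have hembXa : ∀ x a j, embX x (l.succAbove a, j) = x a j := fun x a j => by
    have hne : l.succAbove a ≠ l := Fin.succAbove_ne l a
    show (if h : ((l.succAbove a, j) : Fin 4 × Fin 4).1 = l then (0 : K) else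
      x (σ.symm ⟨(l.succAbove a, j).1, h⟩) (l.succAbove a, j).2) = x a j
    rw [dif_neg hne, hσ a hne]
  have hdecomp : ∀ z : Fin 4 × Fin 4 → K,
      z = embV (fun j => z (l, j)) + embX (fun a j => z (l.succAbove a, j)) := by
    intro z
    funext ⟨i, j⟩
    rcases Fin.eq_self_or_eq_succAbove l i with rfl | ⟨a, rfl⟩
    · rw [Pi.add_apply, hembXl, hembV, if_pos rfl, add_zero]
    · rw [Pi.add_apply, hembXa, hembV, if_neg (Fin.succAbove_ne _ a), zero_add]
  have hker_le : LinearMap.ker bL ≤ LinearMap.range embV := by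
    intro x hx
    refine ⟨fun j => x (l, j), ?_⟩
    funext ⟨i, j⟩
    rw [hembV]
    split_ifs with h
    · simp only at h; rw [h]
    · exact (hrow x (LinearMap.mem_ker.1 hx) i j h).symm
  have hker_eq : LinearMap.ker bL = LinearMap.range embV := by
    refine Submodule.eq_of_le_of_finrank_le hker_le ?_
    rw [hk4]
    exact (LinearMap.finrank_range_le embV).trans (by simp)
  have hEV : ∀ w, bL (embV w) = 0 := fun w =>
    LinearMap.mem_ker.1 (hker_eq ▸ LinearMap.mem_range_self embV w)
  have hEXr : ∀ z, ∃ x, bL (embX x) = bL z := fun z =>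
    ⟨fun a j => z (l.succAbove a, j), by
      conv_rhs => rw [hdecomp z]
      rw [map_add, hEV, zero_add]⟩
  have hper : ∀ (w : Fin 4 → K) (x : Fin 3 → Fin 4 → K) (s : K),
      MvPolynomial.eval (embV w + s • embX x) (perPoly (Fin 4) K) =
        s ^ 3 * (Matrix.of ![w, x 0, x 1, x 2]).permanent := by
    intro w x s
    rw [eval_perPoly]
    refine permanent_of_row_data l _ w x s (fun j => ?_) (fun a j => ?_)
    · rw [Matrix.of_apply, Pi.add_apply, Pi.smul_apply, hembV, if_pos rfl, hembXl, smul_zero,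
        add_zero]
    · rw [Matrix.of_apply, Pi.add_apply, Pi.smul_apply, hembV, if_neg (Fin.succAbove_ne l a),
        hembXa, smul_eq_mul, zero_add]
  -- the base row `𝟙`: affine, determinant constant
  have haff : ∀ z, ∃ e₀ e₁ : K, ∀ s : K,
      MvPolynomial.eval (z + s • embV fun _ => (1 : K)) (perPoly (Fin 4) K) = e₀ + s * e₁ :=
    fun z => affine_of_row K l (embV fun _ => 1) (fun i j hi => by rw [hembV, if_neg hi]) z
  obtain ⟨Γ, M, hflow, hE1⟩ := exists_flow_identities hD hDs bL CL hCs hκ hiii hN hdef embV embX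
    hEV hEXr hper (fun _ => 1) haff (hdet _ (hEV _))
  exact false_of_flow_identities (fun _ => (1 : K)) Γ M hD.ne_zero hκ hflow hE1 hrig

/-- **The one-COLUMN kernel cell at defect `≤ 2` is empty, given hyperplane flow rigidity of
`per [𝟙; ·]`.** [folklore] -/
theorem false_of_col_kernel_of_rigid {D : Matrix ι' ι' K} (hD : IsUnit D.det) (hDs : Dᵀ = D)
    (bL : (Fin 4 × Fin 4 → K) →ₗ[K] (ι' → K))
    (CL : (Fin 4 × Fin 4 → K) →ₗ[K] Matrix ι' ι' K) (hCs : ∀ z, (CL z)ᵀ = CL z)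
    {κ : K} (hκ : κ ≠ 0)
    (hiii : ∀ z, D.det * (bL z ⬝ᵥ (D⁻¹ * CL z * D⁻¹ * CL z * D⁻¹) *ᵥ bL z) =
      -(κ * MvPolynomial.eval z (perPoly (Fin 4) K)))
    (hN : ∀ v, bL v = 0 → IsUnit (D + CL v).det ∧ ∀ (z : Fin 4 × Fin 4 → K) (s : K),
      κ * MvPolynomial.eval (v + s • z) (perPoly (Fin 4) K) =
        (Matrix.fromBlocks ((s * 0) • (1 : Matrix Unit Unit K))
          (Matrix.replicateRow Unit (s • bL z)) (Matrix.replicateCol Unit (s • bL z))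
          (D + CL v + s • CL z)).det)
    (hdef : Fintype.card ι' ≤ 2 * finrank K (LinearMap.range bL) + 2)
    (hdet : ∀ v, bL v = 0 → ∀ t : K, (D + t • CL v).det = D.det)
    (hrig : ∀ (X : (Fin 3 → Fin 4 → K) →ₗ[K] (Fin 3 → Fin 4 → K))
      (ℓ : (Fin 3 → Fin 4 → K) →ₗ[K] K),
      (∀ y, ℓ y = 0 → ∀ t : K,
        (Matrix.of ![fun _ => (1 : K), (y + t • X y) 0, (y + t • X y) 1,
            (y + t • X y) 2]).permanent =
          (Matrix.of ![fun _ => (1 : K), y 0, y 1, y 2]).permanent) →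
      ∃ y, ℓ y = 0 ∧ X y = 0 ∧ (Matrix.of ![fun _ => (1 : K), y 0, y 1, y 2]).permanent ≠ 0)
    (c : Fin 4) (hcol : ∀ x, bL x = 0 → ∀ i j, j ≠ c → x (i, j) = 0)
    (hk4 : finrank K (LinearMap.ker bL) = 4) : False := by
  classical
  let embV : (Fin 4 → K) →ₗ[K] (Fin 4 × Fin 4 → K) :=
    { toFun := fun w p => if p.2 = c then w p.1 else 0
      map_add' := fun w w' => by
        funext p; simp only [Pi.add_apply]; split_ifs <;> simp
      map_smul' := fun c w => by
        funext p; simp only [Pi.smul_apply, smul_eq_mul, RingHom.id_apply]; split_ifs <;> simp }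
  have hembV : ∀ w p, embV w p = if p.2 = c then w p.1 else 0 := fun _ _ => rfl
  let σ := finSuccAboveEquiv c
  have hσ : ∀ a (h : c.succAbove a ≠ c), σ.symm ⟨c.succAbove a, h⟩ = a := fun a h => by
    rw [Equiv.symm_apply_eq]; exact Subtype.ext (finSuccAboveEquiv_apply c a ▸ rfl)
  let embX : (Fin 3 → Fin 4 → K) →ₗ[K] (Fin 4 × Fin 4 → K) :=
    { toFun := fun x p => if h : p.2 = c then 0 else x (σ.symm ⟨p.2, h⟩) p.1
      map_add' := fun x x' => by
        funext p; simp only [Pi.add_apply]; split_ifs <;> simp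
      map_smul' := fun c x => by
        funext p; simp only [Pi.smul_apply, smul_eq_mul, RingHom.id_apply]; split_ifs <;> simp }
  have hembXc : ∀ x i, embX x (i, c) = 0 := fun x i => by
    show (if h : ((i, c) : Fin 4 × Fin 4).2 = c then (0 : K) else _) = 0
    rw [dif_pos rfl]
  have hembXa : ∀ x a i, embX x (i, c.succAbove a) = x a i := fun x a i => by
    have hne : c.succAbove a ≠ c := Fin.succAbove_ne c a
    show (if h : ((i, c.succAbove a) : Fin 4 × Fin 4).2 = c then (0 : K) else
      x (σ.symm ⟨(i, c.succAbove a).2, h⟩) (i, c.succAbove a).1) = x a i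
    rw [dif_neg hne, hσ a hne]
  have hdecomp : ∀ z : Fin 4 × Fin 4 → K,
      z = embV (fun i => z (i, c)) + embX (fun a i => z (i, c.succAbove a)) := by
    intro z
    funext ⟨i, j⟩
    rcases Fin.eq_self_or_eq_succAbove c j with rfl | ⟨a, rfl⟩
    · rw [Pi.add_apply, hembXc, hembV, if_pos rfl, add_zero]
    · rw [Pi.add_apply, hembXa, hembV, if_neg (Fin.succAbove_ne _ a), zero_add]
  have hker_le : LinearMap.ker bL ≤ LinearMap.range embV := by
    intro x hx
    refine ⟨fun i => x (i, c), ?_⟩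
    funext ⟨i, j⟩
    rw [hembV]
    split_ifs with h
    · simp only at h; rw [h]
    · exact (hcol x (LinearMap.mem_ker.1 hx) i j h).symm
  have hker_eq : LinearMap.ker bL = LinearMap.range embV := by
    refine Submodule.eq_of_le_of_finrank_le hker_le ?_
    rw [hk4]
    exact (LinearMap.finrank_range_le embV).trans (by simp)
  have hEV : ∀ w, bL (embV w) = 0 := fun w =>
    LinearMap.mem_ker.1 (hker_eq ▸ LinearMap.mem_range_self embV w)
  have hEXr : ∀ z, ∃ x, bL (embX x) = bL z := fun z =>
    ⟨fun a i => z (i, c.succAbove a), by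
      conv_rhs => rw [hdecomp z]
      rw [map_add, hEV, zero_add]⟩
  have hper : ∀ (w : Fin 4 → K) (x : Fin 3 → Fin 4 → K) (s : K),
      MvPolynomial.eval (embV w + s • embX x) (perPoly (Fin 4) K) =
        s ^ 3 * (Matrix.of ![w, x 0, x 1, x 2]).permanent := by
    intro w x s
    rw [eval_perPoly]
    refine permanent_of_col_data c _ w x s (fun i => ?_) (fun a i => ?_)
    · rw [Matrix.of_apply, Pi.add_apply, Pi.smul_apply, hembV, if_pos rfl, hembXc, smul_zero,
        add_zero]
    · rw [Matrix.of_apply, Pi.add_apply, Pi.smul_apply, hembV, if_neg (Fin.succAbove_ne c a),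
        hembXa, smul_eq_mul, zero_add]
  have haff : ∀ z, ∃ e₀ e₁ : K, ∀ s : K,
      MvPolynomial.eval (z + s • embV fun _ => (1 : K)) (perPoly (Fin 4) K) = e₀ + s * e₁ :=
    fun z => affine_of_col K c (embV fun _ => 1) (fun i j hj => by rw [hembV, if_neg hj]) z
  obtain ⟨Γ, M, hflow, hE1⟩ := exists_flow_identities hD hDs bL CL hCs hκ hiii hN hdef embV embX
    hEV hEXr hper (fun _ => 1) haff (hdet _ (hEV _))
  exact false_of_flow_identities (fun _ => (1 : K)) Γ M hD.ne_zero hκ hflow hE1 hrig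

variable (K)

/-- **The size-`27` cell `(12,4,2)` is empty, given hyperplane flow rigidity of `per [𝟙; ·]`**
(algebraically closed field of characteristic `0`): in the base-point package of a symmetric affine
determinantal representation of `per_4` of size `m ≤ 27`, the space of kernel rows is not
`12`-dimensional.  See the module docstring. [folklore] -/
theorem false_of_rank_twelve_le_twentySeven_of_rigid [IsAlgClosed K] {m : ℕ} (hm : m ≤ 27)
    {i₀ : Fin m} {D : Matrix {i // i ≠ i₀} {i // i ≠ i₀} K}
    {bL : (Fin 4 × Fin 4 → K) →ₗ[K] ({i // i ≠ i₀} → K)}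
    {CL : (Fin 4 × Fin 4 → K) →ₗ[K] Matrix {i // i ≠ i₀} {i // i ≠ i₀} K} {κ : K}
    (hD : IsUnit D.det) (hDs : Dᵀ = D) (hCs : ∀ z, (CL z)ᵀ = CL z) (hκ : κ ≠ 0)
    (hi : ∀ z, bL z ⬝ᵥ D⁻¹ *ᵥ bL z = 0)
    (hii : ∀ z, bL z ⬝ᵥ (D⁻¹ * CL z * D⁻¹) *ᵥ bL z = 0)
    (hiii : ∀ z, D.det * (bL z ⬝ᵥ (D⁻¹ * CL z * D⁻¹ * CL z * D⁻¹) *ᵥ bL z) =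
      -(κ * eval z (perPoly (Fin 4) K)))
    (hcard : Fintype.card {i // i ≠ i₀} + 1 = m)
    (hrn : finrank K (LinearMap.range bL) + finrank K (LinearMap.ker bL) = 16)
    (hN : ∀ v, bL v = 0 → IsUnit (D + CL v).det ∧ ∀ (z : Fin 4 × Fin 4 → K) (s : K),
      κ * eval (v + s • z) (perPoly (Fin 4) K) =
        (Matrix.fromBlocks ((s * 0) • (1 : Matrix Unit Unit K))
          (Matrix.replicateRow Unit (s • bL z)) (Matrix.replicateCol Unit (s • bL z))
          (D + CL v + s • CL z)).det)
    (hrig : ∀ (X : (Fin 3 → Fin 4 → K) →ₗ[K] (Fin 3 → Fin 4 → K))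
      (ℓ : (Fin 3 → Fin 4 → K) →ₗ[K] K),
      (∀ y, ℓ y = 0 → ∀ t : K,
        (Matrix.of ![fun _ => (1 : K), (y + t • X y) 0, (y + t • X y) 1,
            (y + t • X y) 2]).permanent =
          (Matrix.of ![fun _ => (1 : K), y 0, y 1, y 2]).permanent) →
      ∃ y, ℓ y = 0 ∧ X y = 0 ∧ (Matrix.of ![fun _ => (1 : K), y 0, y 1, y 2]).permanent ≠ 0)
    (h12 : finrank K (LinearMap.range bL) = 12) : False := by
  classical
  by_cases hm26 : m ≤ 26
  · exact false_of_rank_twelve_le_twentySix K hm26 hD hDs hCs hκ hi hii hiii hcard hrn hN h12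
  have hk4 : finrank K (LinearMap.ker bL) = 4 := by omega
  have hdef : Fintype.card {i // i ≠ i₀} ≤ 2 * finrank K (LinearMap.range bL) + 2 := by omega
  have hdet : ∀ v, bL v = 0 → ∀ t : K, (D + t • CL v).det = D.det := fun v hv t =>
    det_add_smul_eq_det_of_isAlgClosed D bL CL (fun v hv => (hN v hv).1) v hv t
  -- a TWO-square family along the kernel, so the kernel is one row or one column
  obtain ⟨c, β, hcβ⟩ := sum_sq_of_isotropic_defect_bilinear hD hDs bL CL hCs
    (fun z => eval z (perPoly (Fin 4) K)) hκ hi hii hiii 2 (by omega)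
  have hB : ∀ y ∈ LinearMap.ker bL, ∀ i k j l : Fin 4, i ≠ k → j ≠ l →
      y (i, j) * y (k, l) + y (i, l) * y (k, j) = 0 := fun y hy =>
    perm_two_blocks_of_sum_sq_swap (ι := Fin 2) (by simp) y
      ⟨c, fun k => (β k).flip y, fun u => by
        obtain ⟨e₀, e₁, he⟩ := hcβ u y (LinearMap.mem_ker.1 hy)
        exact ⟨e₀, e₁, fun s => by simpa only [LinearMap.flip_apply] using he s⟩⟩
  rcases row_or_col_of_perm_two_blocks (LinearMap.ker bL) hB hk4 with ⟨l, hl⟩ | ⟨c', hc'⟩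
  · exact false_of_row_kernel_of_rigid hD hDs bL CL hCs hκ hiii hN hdef hdet hrig l
      (fun x hx => hl x (LinearMap.mem_ker.2 hx)) hk4
  · exact false_of_col_kernel_of_rigid hD hDs bL CL hCs hκ hiii hN hdef hdet hrig c'
      (fun x hx => hc' x (LinearMap.mem_ker.2 hx)) hk4

end Summit.ValiantsHypothesis.ValiantsHypothesis.Theorems.SymPencilSdcPerFourCellTwelveFour

end
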